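import Summits.CriticalPhenomena.PercolationContinuityZ3.Theorems.PercNearOneGluingNoHeavyLowerTailSahiE3UnionTensorGates
import Summits.CriticalPhenomena.PercolationContinuityZ3.Theorems.PercNearOneGluingNoHeavyLowerTailSahiE3UnionTensorCube
import Summits.CriticalPhenomena.PercolationContinuityZ3.Theorems.PercNearOneGluingNoHeavyLowerTailSahiC3SixAnyIndex
import HarnessLib

/-!
# `NoHeavyLowerTail` (crux stmt-CriticalPhenomena-4575), Sahi programme P4: Kahn's inequality `E₃ ≥ 0` for GATE-SEPARABLE triples over
# blocks of at most six coins (computational leaf: the tree's `C₃` on six coins)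

Support file (cell `prim-l12`, seat P4, generation 33; `--supports stmt-CriticalPhenomena-4575`; index types in `Type` as in the six-coin leaf; COMPUTATIONAL because the leaf
`SahiC3Cube.sahiPositive_three_bernoulliWeight_of_card_le_six` rests on kernel-evaluated comb certificates).  Companion of the pure file
`…SahiE3UnionTensorGates` (one theorem for all eight member-wise AND/OR gate patterns between two independent positively associated blocks) and
successor of generation 32's `…SahiE3UnionTensorCube` (uniform gates, blocks of `≤ 4` coins).

* `sahiE_three_gateSeparable_step` — THE INDUCTIVE STEP ON CUBES WITH ARBITRARY GATES: for ANY finite `ι₁`, any product measure and increasing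
  `A_i ⊆ 2^{ι₁}` with `E₃(1_{A_0},1_{A_1},1_{A_2}) ≥ 0`, a further independent block `ι₂` of at most SIX coins with increasing `B_i ⊆ 2^{ι₂}`, and any
  gate vector `g : Fin 3 → Bool`, the events "`ω|ι₁ ∈ A_i` OR `ω|ι₂ ∈ B_i`" (`g i = true`) / "`ω|ι₁ ∈ A_i` AND `ω|ι₂ ∈ B_i`" (`g i = false`) on
  `2^{ι₁ ⊔ ι₂}` have `E₃ ≥ 0`.
* `sahiE_three_gateSeparable_nonneg_of_card_le_six` — two blocks of `≤ 6` coins each (up to twelve coins), any gates, any product measure.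
* `sahiE_three_gateSeparable_three_blocks` — the step applied twice: three blocks of `≤ 6` coins (up to eighteen coins), inner gates `g`, outer
  gates `g'`.
Iterating the step along any left bracketing `((ι₁ ⊔ ι₂) ⊔ ι₃) ⊔ ⋯` of a partition of the coordinates into blocks of `≤ 6` coins, with an
arbitrary gate per member at each stage: **Kahn's inequality `E₃(U_0,U_1,U_2) ≥ 0` [Kahn2022, Conj. 5 = Sahi2008, Conj. 5 at `n = 3` for product
measures] holds for every GATE-SEPARABLE triple** — each `U_i` a left-deep read-once AND/OR formula `(⋯((A_i¹ ∘₁ A_i²) ∘₂ A_i³) ⋯)` in increasing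
block events `A_i^j ⊆ 2^{ι_j}` (constants `∅`, `2^{ι_j}` allowed, so members may skip blocks), `∘_j ∈ {∪, ∩}` chosen freely per member and stage —
under every product measure, with any number of blocks.  General (non-left-deep) bracketings follow from the pure lattice-level step
`sahiE_three_gate_nonneg_of_fkg` in the same way.
HONEST FRAMING: an unconditional CLASS for Kahn's Conjecture 5; the conjecture itself (arbitrary increasing `U_i`) is not asserted. [this work]
-/

noncomputable section

namespace Summit.CriticalPhenomena.PercolationContinuityZ3.Theorems.SahiE3UnionTensor

open Finset Function Literature.Combinatorics.Sahi2008
open Literature.Probability.Percolation.DecisionTree (ind ind_of_mem ind_of_not_mem ind_nonneg)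

section GateCube

variable {ι₁ ι₂ : Type} [Fintype ι₁] [Fintype ι₂]

omit [Fintype ι₁] [Fintype ι₂] in
/-- The indicator of a gate-separable event (`cond g (union-separable) (intersection-separable)`) pulls back along `glue` to the gate slot of
the two block indicators. [this work] -/
theorem ind_gateSeparable_comp_glue (g : Bool) (A : Set (Set ι₁)) (B : Set (Set ι₂)) :
    (ind (cond g {ω : Set (ι₁ ⊕ ι₂) | Sum.inl ⁻¹' ω ∈ A ∨ Sum.inr ⁻¹' ω ∈ B} {ω : Set (ι₁ ⊕ ι₂) | Sum.inl ⁻¹' ω ∈ A ∧ Sum.inr ⁻¹' ω ∈ B}))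
        ∘ SahiTotalCumulance.glue =
      fun q : Set ι₁ × Set ι₂ => cond g (ind A q.1 + ind B q.2 - ind A q.1 * ind B q.2) (ind A q.1 * ind B q.2) := by
  cases g
  · exact SahiTotalCumulance.ind_separable_comp_glue A B
  · exact ind_unionSeparable_comp_glue A B

omit [Fintype ι₁] [Fintype ι₂] in
/-- A gate-separable event built from increasing block events is increasing (so the step iterates). [this work] -/
theorem isUpperSet_gateSeparable (g : Bool) {A : Set (Set ι₁)} {B : Set (Set ι₂)} (hA : IsUpperSet A) (hB : IsUpperSet B) :
    IsUpperSet (cond g {ω : Set (ι₁ ⊕ ι₂) | Sum.inl ⁻¹' ω ∈ A ∨ Sum.inr ⁻¹' ω ∈ B}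
      {ω : Set (ι₁ ⊕ ι₂) | Sum.inl ⁻¹' ω ∈ A ∧ Sum.inr ⁻¹' ω ∈ B}) := by
  cases g
  · intro ω ω' hle h
    exact ⟨hA (Set.preimage_mono hle) h.1, hB (Set.preimage_mono hle) h.2⟩
  · exact isUpperSet_unionSeparable hA hB

/-- **The inductive step on cubes, arbitrary gates, leaf blocks of at most six coins.**  For ANY finite `ι₁`, any product measure, increasing
`A_0, A_1, A_2 ⊆ 2^{ι₁}` with `E₃(1_{A_0},1_{A_1},1_{A_2}) ≥ 0`, a block `ι₂` of at most six further coins with increasing `B_i ⊆ 2^{ι₂}`, and any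
gate vector `g : Fin 3 → Bool` (`true` = OR, `false` = AND, member by member), the gate-separable events on `2^{ι₁ ⊔ ι₂}` have `E₃ ≥ 0`.
Leaf: `C₃` on six coins (`SahiC3Cube.sahiPositive_three_bernoulliWeight_of_card_le_six`, computational); engine: `sahiE_three_gate_nonneg_of_sahiPositive_two`.
[this work] -/
theorem sahiE_three_gateSeparable_step (p₁ : ι₁ → unitInterval) (p₂ : ι₂ → unitInterval) (hι₂ : Fintype.card ι₂ ≤ 6) (g : Fin 3 → Bool)
    (A : Fin 3 → Set (Set ι₁)) (B : Fin 3 → Set (Set ι₂)) (hA : ∀ i, IsUpperSet (A i)) (hB : ∀ i, IsUpperSet (B i))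
    (hE : 0 ≤ sahiE (bernoulliWeight p₁) 3 (fun i => ind (A i))) :
    0 ≤ sahiE (bernoulliWeight (Sum.elim p₁ p₂)) 3
      (fun i => ind (cond (g i) {ω : Set (ι₁ ⊕ ι₂) | Sum.inl ⁻¹' ω ∈ A i ∨ Sum.inr ⁻¹' ω ∈ B i}
        {ω : Set (ι₁ ⊕ ι₂) | Sum.inl ⁻¹' ω ∈ A i ∧ Sum.inr ⁻¹' ω ∈ B i})) := by
  rw [← SahiTotalCumulance.pushWeight_glue, sahiE_pushWeight]
  have hfam : (fun i => (ind (cond (g i) {ω : Set (ι₁ ⊕ ι₂) | Sum.inl ⁻¹' ω ∈ A i ∨ Sum.inr ⁻¹' ω ∈ B i}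
        {ω : Set (ι₁ ⊕ ι₂) | Sum.inl ⁻¹' ω ∈ A i ∧ Sum.inr ⁻¹' ω ∈ B i})) ∘ SahiTotalCumulance.glue) =
      fun (i : Fin 3) (q : Set ι₁ × Set ι₂) =>
        cond (g i) (ind (A i) q.1 + ind (B i) q.2 - ind (A i) q.1 * ind (B i) q.2) (ind (A i) q.1 * ind (B i) q.2) := by
    funext i
    exact ind_gateSeparable_comp_glue (g i) (A i) (B i)
  rw [hfam]
  have h₂ := SahiC3Cube.sahiPositive_three_bernoulliWeight_of_card_le_six hι₂ p₂
  exact sahiE_three_gate_nonneg_of_sahiPositive_two (bernoulliWeight p₁) (bernoulliWeight p₂)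
    (isFKGMeasure_bernoulliWeight p₁).nonneg (sum_bernoulliWeight p₁) (isFKGMeasure_bernoulliWeight p₂).nonneg (sum_bernoulliWeight p₂)
    (sahiPositive_two (isFKGMeasure_bernoulliWeight p₁)) (sahiPositive_two (isFKGMeasure_bernoulliWeight p₂))
    (fun i => ind (A i)) (fun i => ind (B i)) (fun i x => ind_nonneg _ _) (fun i x => ind_le_one' _ _)
    (fun i => SahiTotalCumulance.monotone_ind_of_isUpperSet (hA i))
    (fun i y => ind_nonneg _ _) (fun i y => ind_le_one' _ _) (fun i => SahiTotalCumulance.monotone_ind_of_isUpperSet (hB i))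
    hE (h₂ _ (fun i y => ind_nonneg _ _) fun i => SahiTotalCumulance.monotone_ind_of_isUpperSet (hB i)) g

/-- **Two blocks of at most six coins each, arbitrary gates**: on `2^{ι₁ ⊔ ι₂}` with `|ι₁|, |ι₂| ≤ 6` and ANY product measure, for increasing
`A_i ⊆ 2^{ι₁}`, `B_i ⊆ 2^{ι₂}` and any gate vector, the gate-separable triple (member `i`: `A_i`-OR-`B_i` or `A_i`-AND-`B_i`) has `E₃ ≥ 0` —
up to twelve coins. [this work] -/
theorem sahiE_three_gateSeparable_nonneg_of_card_le_six (hι₁ : Fintype.card ι₁ ≤ 6) (hι₂ : Fintype.card ι₂ ≤ 6)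
    (p₁ : ι₁ → unitInterval) (p₂ : ι₂ → unitInterval) (g : Fin 3 → Bool)
    (A : Fin 3 → Set (Set ι₁)) (B : Fin 3 → Set (Set ι₂)) (hA : ∀ i, IsUpperSet (A i)) (hB : ∀ i, IsUpperSet (B i)) :
    0 ≤ sahiE (bernoulliWeight (Sum.elim p₁ p₂)) 3
      (fun i => ind (cond (g i) {ω : Set (ι₁ ⊕ ι₂) | Sum.inl ⁻¹' ω ∈ A i ∨ Sum.inr ⁻¹' ω ∈ B i}
        {ω : Set (ι₁ ⊕ ι₂) | Sum.inl ⁻¹' ω ∈ A i ∧ Sum.inr ⁻¹' ω ∈ B i})) :=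
  sahiE_three_gateSeparable_step p₁ p₂ hι₂ g A B hA hB
    (SahiC3Cube.sahiPositive_three_bernoulliWeight_of_card_le_six hι₁ p₁ _ (fun i x => ind_nonneg (A i) x)
      fun i => SahiTotalCumulance.monotone_ind_of_isUpperSet (hA i))

/-- **Three blocks of at most six coins, two gate layers** (the step applied twice): on `2^{(ι₁ ⊔ ι₂) ⊔ ι₃}` with `|ι₁|, |ι₂|, |ι₃| ≤ 6` and any
product measure, increasing block events `A_i, B_i, C_i`, inner gates `g` (between `A_i` and `B_i`) and outer gates `g'` (with `C_i`): the triple of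
events `(A_i ∘_{g i} B_i) ∘_{g' i} C_i` has `E₃ ≥ 0` — up to eighteen coins; further blocks in the same way. [this work] -/
theorem sahiE_three_gateSeparable_three_blocks {ι₃ : Type} [Fintype ι₃]
    (hι₁ : Fintype.card ι₁ ≤ 6) (hι₂ : Fintype.card ι₂ ≤ 6) (hι₃ : Fintype.card ι₃ ≤ 6)
    (p₁ : ι₁ → unitInterval) (p₂ : ι₂ → unitInterval) (p₃ : ι₃ → unitInterval) (g g' : Fin 3 → Bool)
    (A : Fin 3 → Set (Set ι₁)) (B : Fin 3 → Set (Set ι₂)) (C : Fin 3 → Set (Set ι₃))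
    (hA : ∀ i, IsUpperSet (A i)) (hB : ∀ i, IsUpperSet (B i)) (hC : ∀ i, IsUpperSet (C i)) :
    0 ≤ sahiE (bernoulliWeight (Sum.elim (Sum.elim p₁ p₂) p₃)) 3
      (fun i => ind (cond (g' i)
        {ω : Set ((ι₁ ⊕ ι₂) ⊕ ι₃) |
          Sum.inl ⁻¹' ω ∈ cond (g i) {ω' : Set (ι₁ ⊕ ι₂) | Sum.inl ⁻¹' ω' ∈ A i ∨ Sum.inr ⁻¹' ω' ∈ B i}
              {ω' : Set (ι₁ ⊕ ι₂) | Sum.inl ⁻¹' ω' ∈ A i ∧ Sum.inr ⁻¹' ω' ∈ B i} ∨ Sum.inr ⁻¹' ω ∈ C i}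
        {ω : Set ((ι₁ ⊕ ι₂) ⊕ ι₃) |
          Sum.inl ⁻¹' ω ∈ cond (g i) {ω' : Set (ι₁ ⊕ ι₂) | Sum.inl ⁻¹' ω' ∈ A i ∨ Sum.inr ⁻¹' ω' ∈ B i}
              {ω' : Set (ι₁ ⊕ ι₂) | Sum.inl ⁻¹' ω' ∈ A i ∧ Sum.inr ⁻¹' ω' ∈ B i} ∧ Sum.inr ⁻¹' ω ∈ C i})) :=
  sahiE_three_gateSeparable_step (Sum.elim p₁ p₂) p₃ hι₃ g'
    (fun i => cond (g i) {ω' : Set (ι₁ ⊕ ι₂) | Sum.inl ⁻¹' ω' ∈ A i ∨ Sum.inr ⁻¹' ω' ∈ B i}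
      {ω' : Set (ι₁ ⊕ ι₂) | Sum.inl ⁻¹' ω' ∈ A i ∧ Sum.inr ⁻¹' ω' ∈ B i}) C
    (fun i => isUpperSet_gateSeparable (g i) (hA i) (hB i)) hC
    (sahiE_three_gateSeparable_nonneg_of_card_le_six hι₁ hι₂ p₁ p₂ g A B hA hB)

end GateCube

end Summit.CriticalPhenomena.PercolationContinuityZ3.Theorems.SahiE3UnionTensor

end
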